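import Summits.RiemannHypothesis.RiemannHypothesis.Theorems.PlantedLiBlindness

/-!
# W-06 cycle 7 «DETECTION COST ATLAS», cell C4⁷-bis — the LI BLINDNESS LAW, KERNEL (rh-idea-6 g15) — part (ii) of two: the LOW range

(CA116)/(CA137) lane slot (4b-ii): §4 (rev 2) = l.352–626 VERBATIM of `pub/ideators/rh-idea-6/g15/c47b/PlantedLiBlind-rh-idea-6-g15-rev2.lean`
sha16 458d796713b70991 · 630 (ns `RhIdea6.G15.C47b`, continued), on top of part (i) `Theorems/PlantedLiBlindness.lean` (§1–§3:
`blindL_holds`, `norm_one_sub_inv_rho_le_one`, `norm_one_sub_inv_rho'_pow_le`, `plantedLi_pos_DH`, …) by ONE import.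
RE-CUT of the desk cut of record `PlantedLiBlindness.lean` 05421ef16d445f56 · 521 at its §3/§4 boundary (400-line lint,
p711378), body byte-verbatim except (rev 2): the top-level lemma `le_arcsin_of_nonneg` (`0 ≤ t ≤ 1 → t ≤ arcsin t`) is DROPPED —
it restates the tree's `…YangMills.Theorems.ToronSmallBallOwnAxisShiftDomination.le_arcsin_self` (`dedup.landed` risk) — and its
2-line proof is inlined at the single use site in `re_one_sub_inv_rho'_pow_lt_one_of_window`.  Credit rh-idea-6 g15.
LABEL: RH-FREE PROOF-OF-DATA about a PLANTED sequence (model A); tier K (0 `sorry`, standard axioms).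
What is proved here: `plantedLi_pos_low` (`150 ≤ γ → 0 ≤ δ < 1/2 → 1 ≤ n ≤ 899 → 0 < plantedLi γ δ n`, phase window +
`keiperLiCoeff_nonneg_of_le_13815510`), `plantedLi_pos_upTo` (the FULL law `1 ≤ n ≤ b_L(γ, δ)` for `γ ≥ 150` under
`RiemannHypothesisUpTo T`, `b_L ≤ T²`), `plantedLi_pos_upTo_height1000` (RH-free at `T = 10³`), `plantedLi_pos_DH_low`
(`1 ≤ n ≤ 476`).  Nothing here bears on the truth of RH.
-/

noncomputable section

namespace RhIdea6.G15.C47b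

open Literature.NumberTheory.LFunctions Literature.NumberTheory.DiophantineGeometry
open Summit.RiemannHypothesis.RiemannHypothesis.Theorems.LiTheory
open RhIdea4.G14.W06C67

/-! ### §4 (rev 2) The LOW range `1 ≤ n ≤ 899` — the planted term is positive in its first phase window

Polar form `Re (1 − 1/ρ′)ⁿ = ‖1 − 1/ρ′‖ⁿ · cos(n · arg(1 − 1/ρ′))` with `arg(1 − 1/ρ′) = arcsin(Im/‖·‖) ∈ [t, 1.001·t]`,
`t = Im(1 − 1/ρ′)/‖1 − 1/ρ′‖ ≤ 1/γ`, and `‖1 − 1/ρ′‖ⁿ ≤ e^{y}`, `y = nδ/((½ − δ)² + γ²) ≤ 0.02`; `cos u ≤ 1/√(u² + 1)` on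
`[−3π/2, 3π/2]` (`Real.cos_le_one_div_sqrt_sq_add_one`) and `cos u = cos(2π − u)` beyond.  For `γ ≥ 150`, `2 ≤ n ≤ 899`
the phase `u = n·arg ≤ 1.001·899/150 < 2π − 0.2837`, whence `Re (1 − 1/ρ′)ⁿ < 1` (`n = 1` directly); `Re (1 − 1/ρ)ⁿ ≤ 1`
always; so `plantedLiTerm γ δ n > 0`, and with `λ_n ≥ 0` (`keiperLiCoeff_nonneg_of_le_13815510`, KERNEL, `T = 10³`)
`plantedLi γ δ n > 0` for `1 ≤ n ≤ 899` — closing the gap below the all-range law's threshold `n ≥ 900` for `γ ≥ 150`.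
(For `100 ≤ γ < 150` the phase passes `2π` inside `[610, 899]`, where the planted term dips to `≈ −4(cosh y − 1) ≈ −10⁻³`
and the tree has `λ_n ≥ 0` only there — any margin `λ_n ≥ 10⁻²` on `120 ≤ n ≤ 899` would close it; NOT CLAIMED.) -/

/-- Polar form of the real part of a power: `Re zⁿ = ‖z‖ⁿ cos(n · arg z)` (`z ≠ 0`). -/
theorem re_pow_eq_norm_pow_mul_cos {z : ℂ} (hz : z ≠ 0) (n : ℕ) :
    (z ^ n).re = ‖z‖ ^ n * Real.cos (n * Complex.arg z) := by
  conv_lhs => rw [← Complex.exp_log hz, ← Complex.exp_nat_mul]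
  rw [Complex.exp_re]
  have hre : ((n : ℂ) * Complex.log z).re = n * Real.log ‖z‖ := by
    simp [Complex.mul_re, Complex.log_re]
  have him : ((n : ℂ) * Complex.log z).im = n * Complex.arg z := by
    simp [Complex.mul_im, Complex.log_im]
  rw [hre, him, Real.exp_nat_mul, Real.exp_log (norm_pos_iff.mpr hz)]

/-- Phase-window lemma I: `0 ≤ r`, `r² < u² + 1`, `|u| ≤ 3π/2 ⟹ r·cos u < 1` (`cos u ≤ 1/√(u² + 1)`). -/
theorem mul_cos_lt_one_of_sq_lt {r u : ℝ} (hr0 : 0 ≤ r) (hr : r ^ 2 < u ^ 2 + 1)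
    (hu1 : -(3 * Real.pi / 2) ≤ u) (hu2 : u ≤ 3 * Real.pi / 2) : r * Real.cos u < 1 := by
  have hcos : Real.cos u ≤ 1 / Real.sqrt (u ^ 2 + 1) := Real.cos_le_one_div_sqrt_sq_add_one hu1 hu2
  have hs : 0 < Real.sqrt (u ^ 2 + 1) := Real.sqrt_pos.mpr (by positivity)
  have hlt : r < Real.sqrt (u ^ 2 + 1) := (Real.lt_sqrt hr0).mpr hr
  calc r * Real.cos u ≤ r * (1 / Real.sqrt (u ^ 2 + 1)) := mul_le_mul_of_nonneg_left hcos hr0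
    _ = r / Real.sqrt (u ^ 2 + 1) := by ring
    _ < 1 := (div_lt_one hs).mpr hlt

/-- Phase-window lemma II (past `3π/2`, before `2π`): `0 ≤ r`, `r² < (2π − u)² + 1`, `π/2 ≤ u ≤ 7π/2 ⟹ r·cos u < 1`. -/
theorem mul_cos_lt_one_of_sq_lt' {r u : ℝ} (hr0 : 0 ≤ r) (hr : r ^ 2 < (2 * Real.pi - u) ^ 2 + 1)
    (hu1 : Real.pi / 2 ≤ u) (hu2 : u ≤ 7 * Real.pi / 2) : r * Real.cos u < 1 := by
  have hcosv : Real.cos u = Real.cos (2 * Real.pi - u) := by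
    rw [← Real.cos_neg (2 * Real.pi - u), neg_sub, Real.cos_sub_two_pi]
  rw [hcosv]
  exact mul_cos_lt_one_of_sq_lt hr0 hr (by linarith) (by linarith)

/-- `arcsin t ≤ 1.001·t` for `0 ≤ t ≤ 1/20` (`sin x > x − x³/6`). -/
theorem arcsin_le_of_small {t : ℝ} (ht0 : 0 ≤ t) (ht : t ≤ 1 / 20) : Real.arcsin t ≤ 1.001 * t := by
  rcases eq_or_lt_of_le ht0 with h0 | hpos
  · rw [← h0]; simp
  · rw [Real.arcsin_le_iff_le_sin' ⟨by linarith [Real.pi_gt_three], by linarith [Real.pi_gt_three]⟩]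
    have h3 := Real.sin_gt_sub_cube (x := 1.001 * t) (by positivity)
    have ht2 : t * t ≤ 1 / 400 := by nlinarith
    have hcube : (1.001 * t) ^ 3 / 6 ≤ 0.001 * t := by
      have e : (1.001 * t) ^ 3 / 6 = (1.001 ^ 3 / 6) * (t * t) * t := by ring
      rw [e]
      have := mul_le_mul_of_nonneg_right (mul_le_mul_of_nonneg_left ht2 (by norm_num : (0:ℝ) ≤ 1.001 ^ 3 / 6)) ht0
      linarith
    linarith

/-- The key size inequality of the first window: `2 ≤ n`, `0 ≤ δ < ½`, `γ² ≥ 400 ⟹ 2.08·(nδ)·((δ+½)² + γ²) < n²γ²`. -/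
theorem key_ineq {n δ γ : ℝ} (hn : 2 ≤ n) (hδ : 0 ≤ δ) (hδ' : δ < 1 / 2) (hγ2 : 400 ≤ γ ^ 2) :
    2.08 * (n * δ) * ((δ + 1/2) ^ 2 + γ ^ 2) < n ^ 2 * γ ^ 2 := by
  have hn0 : 0 ≤ n := by linarith
  have hB : (δ + 1/2) ^ 2 + γ ^ 2 ≤ 1 + γ ^ 2 := by nlinarith
  have hB0 : 0 ≤ (δ + 1/2) ^ 2 + γ ^ 2 := by positivity
  have h1 : 2.08 * (n * δ) * ((δ + 1/2) ^ 2 + γ ^ 2) ≤ 2.08 * (n * δ) * (1 + γ ^ 2) :=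
    mul_le_mul_of_nonneg_left hB (by positivity)
  have h2 : 2.08 * (n * δ) * (1 + γ ^ 2) ≤ 1.04 * n * (1 + γ ^ 2) := by
    have : n * δ ≤ n * (1/2) := mul_le_mul_of_nonneg_left hδ'.le hn0
    nlinarith
  have h3 : 1.04 * n * (1 + γ ^ 2) < n ^ 2 * γ ^ 2 := by
    have h4 : 1.04 * (1 + γ ^ 2) < 2 * γ ^ 2 := by nlinarith
    have h5 : 2 * γ ^ 2 * n ≤ n ^ 2 * γ ^ 2 := by nlinarith [mul_le_mul_of_nonneg_left hn (by positivity : (0:ℝ) ≤ γ ^ 2)]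
    nlinarith
  linarith

/-- Real part of the growing factor: `Re(1 − 1/ρ′) = 1 − (½ − δ)/((½ − δ)² + γ²)`. -/
theorem one_sub_inv_rho'_re (γ δ : ℝ) :
    (1 - 1 / rho' γ δ).re = 1 - (1/2 - δ) / ((1/2 - δ) ^ 2 + γ ^ 2) := by
  simp [rho', Complex.normSq_mk, sq]

/-- Imaginary part of the growing factor: `Im(1 − 1/ρ′) = γ/((½ − δ)² + γ²)`. -/
theorem one_sub_inv_rho'_im (γ δ : ℝ) :
    (1 - 1 / rho' γ δ).im = γ / ((1/2 - δ) ^ 2 + γ ^ 2) := by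
  simp [rho', Complex.normSq_mk, sq, neg_div]

set_option maxHeartbeats 400000 in
/-- **The growing factor's real part stays below `1` in the first phase window (general form)**:
`γ ≥ 20`, `0 ≤ δ < ½`, `1 ≤ n`, PHASE `1.001·n ≤ 5.9994·γ` and GROWTH `n·δ ≤ 0.02·γ²` ⟹ `Re (1 − 1/ρ′)ⁿ < 1`. -/
theorem re_one_sub_inv_rho'_pow_lt_one_of_window {γ δ : ℝ} {n : ℕ} (hγ : 20 ≤ γ) (hδ : 0 ≤ δ)
    (hδ' : δ < 1 / 2) (hn1 : 1 ≤ n) (hwin : 1.001 * (n : ℝ) ≤ 5.9994 * γ)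
    (hyb : (n : ℝ) * δ ≤ 0.02 * γ ^ 2) : ((1 - 1 / rho' γ δ) ^ n).re < 1 := by
  have hγ0 : 0 < γ := by linarith
  have hγ2 : 400 ≤ γ ^ 2 := by nlinarith
  have hA : 0 < (1/2 - δ) ^ 2 + γ ^ 2 := by positivity
  have hB : 0 < (δ + 1/2) ^ 2 + γ ^ 2 := by positivity
  have hA' : (δ - 1/2) ^ 2 + γ ^ 2 = (1/2 - δ) ^ 2 + γ ^ 2 := by ring
  have hre := one_sub_inv_rho'_re γ δ
  have him := one_sub_inv_rho'_im γ δ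
  -- n = 1: directly
  rcases eq_or_lt_of_le hn1 with h1 | hn2
  · rw [← h1, pow_one, hre, sub_lt_self_iff]
    exact div_pos (by linarith) hA
  -- the factor z := 1 − 1/ρ′ and its sizes
  obtain ⟨z, hz_def⟩ : ∃ z : ℂ, z = 1 - 1 / rho' γ δ := ⟨_, rfl⟩
  rw [← hz_def] at hre him ⊢
  have hre_pos : 0 < z.re := by
    rw [hre, sub_pos, div_lt_one hA]; nlinarith
  have hz0 : z ≠ 0 := fun h => by rw [h] at hre_pos; simp at hre_pos
  have him_pos : 0 < z.im := by rw [him]; positivity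
  have hnormSq : ‖z‖ ^ 2 = ((δ + 1/2) ^ 2 + γ ^ 2) / ((1/2 - δ) ^ 2 + γ ^ 2) := by
    rw [← Complex.normSq_eq_norm_sq, hz_def, normSq_one_sub_inv_rho' γ δ hA.ne', hA']
  have hnorm_ge : 1 ≤ ‖z‖ := by
    have hsq : 1 ≤ ‖z‖ ^ 2 := by
      rw [hnormSq, le_div_iff₀ hA]; nlinarith
    nlinarith [norm_nonneg z]
  -- growth: (‖z‖ⁿ)² ≤ 1 + 2.08·y, y = nδ/A ≤ 0.02
  have hn2' : (2 : ℝ) ≤ n := by exact_mod_cast hn2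
  have hn0 : (0 : ℝ) ≤ n := by linarith
  obtain ⟨y, hy_def⟩ : ∃ y : ℝ, y = (n : ℝ) * δ / ((1/2 - δ) ^ 2 + γ ^ 2) := ⟨_, rfl⟩
  have hpow : ‖z‖ ^ n ≤ Real.exp y := by
    have h := norm_one_sub_inv_rho'_pow_le (δ := δ) hγ0.ne' n
    rw [← hz_def, hA'] at h
    rw [hy_def, mul_div_assoc]
    exact h
  have hy0 : 0 ≤ y := by rw [hy_def]; positivity
  have hy : y ≤ 0.02 := by
    rw [hy_def, div_le_iff₀ hA]
    nlinarith [sq_nonneg (1/2 - δ)]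
  have hN0 : 0 ≤ ‖z‖ ^ n := pow_nonneg (norm_nonneg _) n
  have hE2 : (‖z‖ ^ n) ^ 2 ≤ 1 + 2.08 * y := by
    have h1 : (‖z‖ ^ n) ^ 2 ≤ Real.exp y ^ 2 := pow_le_pow_left₀ hN0 hpow 2
    have h2 : Real.exp y ^ 2 = Real.exp (2 * y) := by rw [← Real.exp_nat_mul]; norm_num
    have h3 := Real.abs_exp_sub_one_sub_id_le (x := 2 * y) (by rw [abs_of_nonneg (by linarith)]; linarith)
    have h4 := (abs_le.1 h3).2
    have h5 : (2 * y) ^ 2 ≤ 0.08 * y := by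
      have e : (2 * y) ^ 2 = 4 * (y * y) := by ring
      rw [e]; nlinarith [mul_le_mul_of_nonneg_left hy hy0]
    rw [h2] at h1; linarith
  -- the phase: arg z = arcsin t, t = Im z/‖z‖ ∈ [0, 1/150]
  obtain ⟨t, ht_def⟩ : ∃ t : ℝ, t = z.im / ‖z‖ := ⟨_, rfl⟩
  have ht0 : 0 ≤ t := by rw [ht_def]; exact div_nonneg him_pos.le (norm_nonneg z)
  have ht_le_im : t ≤ z.im := by rw [ht_def]; exact div_le_self him_pos.le hnorm_ge
  have him_le : z.im ≤ 1 / γ := by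
    rw [him, div_le_div_iff₀ hA hγ0]; nlinarith [sq_nonneg (1/2 - δ)]
  have hγinv : 1 / γ ≤ 1 / 20 := by
    rw [div_le_div_iff₀ hγ0 (by norm_num)]; linarith
  have ht_small : t ≤ 1 / 20 := (ht_le_im.trans him_le).trans hγinv
  have harg : Complex.arg z = Real.arcsin t := by rw [ht_def]; exact Complex.arg_of_re_nonneg hre_pos.le
  have harcsin0 : 0 ≤ Real.arcsin t := Real.arcsin_nonneg.mpr ht0
  have harcsin_ge : t ≤ Real.arcsin t := by
    -- `t ≤ arcsin t` on `[0, 1]` (inlined: the cut's top-level `le_arcsin_of_nonneg` restated the tree's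
    -- `Summits.QuantumFields.YangMills.Theorems.ToronSmallBallOwnAxisShiftDomination.le_arcsin_self`, a `dedup.landed` risk)
    have h := Real.sin_le harcsin0
    rwa [Real.sin_arcsin (by linarith) (by linarith)] at h
  have harcsin_le : Real.arcsin t ≤ 1.001 * t := arcsin_le_of_small ht0 ht_small
  obtain ⟨u, hu_def⟩ : ∃ u : ℝ, u = (n : ℝ) * Real.arcsin t := ⟨_, rfl⟩
  have hu0 : 0 ≤ u := by rw [hu_def]; exact mul_nonneg hn0 harcsin0
  have hu_ge : (n : ℝ) * t ≤ u := by rw [hu_def]; exact mul_le_mul_of_nonneg_left harcsin_ge hn0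
  have hu_le : u ≤ 5.9994 := by
    have h1 : u ≤ (n : ℝ) * (1.001 * t) := by rw [hu_def]; exact mul_le_mul_of_nonneg_left harcsin_le hn0
    have h2 : (n : ℝ) * (1.001 * t) ≤ (n : ℝ) * (1.001 * (1 / γ)) :=
      mul_le_mul_of_nonneg_left (by linarith [ht_le_im.trans him_le]) hn0
    have h3 : (n : ℝ) * (1.001 * (1 / γ)) ≤ 5.9994 := by
      rw [show (n : ℝ) * (1.001 * (1 / γ)) = 1.001 * n / γ by ring, div_le_iff₀ hγ0]
      exact hwin
    linarith [h2]
  -- t²·B = γ²/A, hence 2.08·y < (n t)²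
  have ht_sq : t ^ 2 * ((δ + 1/2) ^ 2 + γ ^ 2) = γ ^ 2 / ((1/2 - δ) ^ 2 + γ ^ 2) := by
    rw [ht_def, div_pow, hnormSq, him]
    field_simp
  have hkey : 2.08 * y < ((n : ℝ) * t) ^ 2 := by
    refine lt_of_mul_lt_mul_right ?_ hB.le
    have e1 : ((n : ℝ) * t) ^ 2 * ((δ + 1/2) ^ 2 + γ ^ 2) = (n : ℝ) ^ 2 * γ ^ 2 / ((1/2 - δ) ^ 2 + γ ^ 2) := by
      rw [mul_pow, mul_assoc, ht_sq]; ring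
    have e2 : 2.08 * y * ((δ + 1/2) ^ 2 + γ ^ 2)
        = 2.08 * ((n : ℝ) * δ) * ((δ + 1/2) ^ 2 + γ ^ 2) / ((1/2 - δ) ^ 2 + γ ^ 2) := by
      rw [hy_def]; ring
    rw [e1, e2, div_lt_div_iff_of_pos_right hA]
    exact key_ineq hn2' hδ hδ' hγ2
  have hsq_lt : (‖z‖ ^ n) ^ 2 < u ^ 2 + 1 := by
    have : ((n : ℝ) * t) ^ 2 ≤ u ^ 2 := pow_le_pow_left₀ (mul_nonneg hn0 ht0) hu_ge 2
    linarith
  -- conclude by the phase-window lemmas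
  rw [re_pow_eq_norm_pow_mul_cos hz0 n, harg, ← hu_def]
  have hπ := Real.pi_gt_d6
  have hπ' := Real.pi_lt_d6
  by_cases hcase : u ≤ 3 * Real.pi / 2
  · exact mul_cos_lt_one_of_sq_lt hN0 hsq_lt (by linarith only [hu0, Real.pi_pos]) hcase
  · rw [not_le] at hcase
    refine mul_cos_lt_one_of_sq_lt' hN0 ?_ (by linarith only [hcase, hπ]) (by linarith only [hu_le, hπ])
    have hv : 0.2837 ≤ 2 * Real.pi - u := by linarith only [hu_le, hπ]
    have hv2 : (0.2837 : ℝ) * 0.2837 ≤ (2 * Real.pi - u) * (2 * Real.pi - u) :=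
      mul_le_mul hv hv (by norm_num) (by linarith)
    have h1 : (‖z‖ ^ n) ^ 2 ≤ 1.0416 := by linarith only [hE2, hy]
    have e : (2 * Real.pi - u) ^ 2 = (2 * Real.pi - u) * (2 * Real.pi - u) := sq _
    linarith only [h1, hv2, e]

/-- **First window at `γ ≥ 150`**: `0 ≤ δ < ½`, `1 ≤ n ≤ 899 ⟹ Re (1 − 1/ρ′)ⁿ < 1`
(`1.001·899 = 899.9 ≤ 5.9994·150 = 899.91`; `899·½ = 449.5 ≤ 0.02·150² = 450`). -/
theorem re_one_sub_inv_rho'_pow_lt_one {γ δ : ℝ} {n : ℕ} (hγ : 150 ≤ γ) (hδ : 0 ≤ δ) (hδ' : δ < 1 / 2)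
    (hn1 : 1 ≤ n) (hn : n ≤ 899) : ((1 - 1 / rho' γ δ) ^ n).re < 1 := by
  have hn' : (n : ℝ) ≤ 899 := by exact_mod_cast hn
  have hn0 : (0 : ℝ) ≤ n := Nat.cast_nonneg n
  refine re_one_sub_inv_rho'_pow_lt_one_of_window (by linarith) hδ hδ' hn1 (by linarith) ?_
  have h1 : (n : ℝ) * δ ≤ 899 * (1 / 2) := mul_le_mul hn' hδ'.le hδ (by norm_num)
  nlinarith

/-- The decaying factor's real part is at most `1`: `Re (1 − 1/ρ)ⁿ ≤ ‖1 − 1/ρ‖ⁿ ≤ 1`. -/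
theorem re_one_sub_inv_rho_pow_le_one {γ δ : ℝ} (hδ : 0 ≤ δ) (hγ : γ ≠ 0) (n : ℕ) :
    ((1 - 1 / rho γ δ) ^ n).re ≤ 1 := by
  refine (Complex.re_le_norm _).trans ?_
  rw [norm_pow]
  exact pow_le_one₀ (norm_nonneg _) (norm_one_sub_inv_rho_le_one hδ hγ)

/-- **PLANTED TERM IN THE FIRST WINDOW (general)**: `γ ≥ 20`, `0 ≤ δ < ½`, `1 ≤ n`, `1.001 n ≤ 5.9994 γ`,
`nδ ≤ 0.02 γ² ⟹ plantedLiTerm γ δ n > 0`. -/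
theorem plantedLiTerm_pos_of_window {γ δ : ℝ} {n : ℕ} (hγ : 20 ≤ γ) (hδ : 0 ≤ δ) (hδ' : δ < 1 / 2)
    (hn1 : 1 ≤ n) (hwin : 1.001 * (n : ℝ) ≤ 5.9994 * γ) (hyb : (n : ℝ) * δ ≤ 0.02 * γ ^ 2) :
    0 < plantedLiTerm γ δ n := by
  have hγ0 : γ ≠ 0 := by intro h; rw [h] at hγ; norm_num at hγ
  have h1 := re_one_sub_inv_rho_pow_le_one hδ hγ0 n
  have h2 := re_one_sub_inv_rho'_pow_lt_one_of_window hγ hδ hδ' hn1 hwin hyb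
  unfold plantedLiTerm
  rw [Complex.add_re]
  linarith

/-- **BLINDNESS IN THE FIRST WINDOW (KERNEL, unconditional)**: as above and `n ≤ 13 815 510 ⟹ plantedLi γ δ n > 0`. -/
theorem plantedLi_pos_of_window {γ δ : ℝ} {n : ℕ} (hγ : 20 ≤ γ) (hδ : 0 ≤ δ) (hδ' : δ < 1 / 2)
    (hn1 : 1 ≤ n) (hn : n ≤ 13815510) (hwin : 1.001 * (n : ℝ) ≤ 5.9994 * γ)
    (hyb : (n : ℝ) * δ ≤ 0.02 * γ ^ 2) : 0 < plantedLi γ δ n := by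
  have h0 := keiperLiCoeff_nonneg_of_le_13815510 hn1 hn
  have h1 := plantedLiTerm_pos_of_window hγ hδ hδ' hn1 hwin hyb
  unfold plantedLi
  linarith

/-- **DH CALIBRATION, low range** (`γ₁ = 85.699`, `δ₁ = 0.3085`): `1 ≤ n ≤ 476 ⟹ plantedLi > 0`
(growth `476·0.3085 = 146.85 ≤ 0.02·85.699² = 146.89`; phase `1.001·476 ≤ 5.9994·85.699`).  Together with
`plantedLi_pos_DH` (`900 ≤ n ≤ 23806`) and `plantedLi_pos_DH_log` (to `b_L = 1.92·10⁵`) the DH column is kernel-blind on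
`[1, 476] ∪ [900, 1.92·10⁵]`; on `[477, 899]` the phase passes `2π` (`n ≈ 538`) and the tree has `λ_n ≥ 0` only. -/
theorem plantedLi_pos_DH_low {n : ℕ} (hn1 : 1 ≤ n) (hn : n ≤ 476) : 0 < plantedLi 85.699 0.3085 n := by
  have hn' : (n : ℝ) ≤ 476 := by exact_mod_cast hn
  refine plantedLi_pos_of_window (by norm_num) (by norm_num) (by norm_num) hn1 (by omega) ?_ ?_
  · linarith
  · nlinarith

/-- **LOW-RANGE PLANTED TERM**: `γ ≥ 150`, `0 ≤ δ < ½`, `1 ≤ n ≤ 899 ⟹ plantedLiTerm γ δ n > 0`. -/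
theorem plantedLiTerm_pos_low {γ δ : ℝ} {n : ℕ} (hγ : 150 ≤ γ) (hδ : 0 ≤ δ) (hδ' : δ < 1 / 2)
    (hn1 : 1 ≤ n) (hn : n ≤ 899) : 0 < plantedLiTerm γ δ n := by
  have hγ0 : γ ≠ 0 := by intro h; rw [h] at hγ; norm_num at hγ
  have h1 := re_one_sub_inv_rho_pow_le_one hδ hγ0 n
  have h2 := re_one_sub_inv_rho'_pow_lt_one hγ hδ hδ' hn1 hn
  unfold plantedLiTerm
  rw [Complex.add_re]
  linarith

/-- **LOW-RANGE BLINDNESS (KERNEL, unconditional)**: `γ ≥ 150`, `0 ≤ δ < ½`, `1 ≤ n ≤ 899 ⟹ plantedLi γ δ n > 0`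
(`λ_n ≥ 0` for `n ≤ 13 815 510` is the tree's kernel theorem at `T = 10³`). -/
theorem plantedLi_pos_low {γ δ : ℝ} {n : ℕ} (hγ : 150 ≤ γ) (hδ : 0 ≤ δ) (hδ' : δ < 1 / 2)
    (hn1 : 1 ≤ n) (hn : n ≤ 899) : 0 < plantedLi γ δ n := by
  have h0 := keiperLiCoeff_nonneg_of_le_13815510 hn1 (by omega)
  have h1 := plantedLiTerm_pos_low hγ hδ hδ' hn1 hn
  unfold plantedLi
  linarith

/-- **THE FULL LI BLINDNESS LAW for `γ ≥ 150`**: RH verified to `T ≥ 1000`, `0 < δ < ½`, `b_L(γ,δ) ≤ T²` ⟹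
`plantedLi γ δ n > 0` for EVERY `1 ≤ n ≤ b_L(γ, δ)` (low range §4 + `blindL_holds`). -/
theorem plantedLi_pos_upTo {T γ δ : ℝ} {n : ℕ} (hT : 1000 ≤ T) (hRH : RiemannHypothesisUpTo T)
    (hγ : 150 ≤ γ) (hδ : 0 < δ) (hδ' : δ < 1 / 2) (hb : liBlindDegree γ δ ≤ T ^ 2)
    (hn1 : 1 ≤ n) (hnb : (n : ℝ) ≤ liBlindDegree γ δ) : 0 < plantedLi γ δ n := by
  by_cases h : 900 ≤ n
  · exact blindL_holds hT hRH (by linarith) hδ hδ' hb n h hnb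
  · exact plantedLi_pos_low hγ hδ.le hδ' hn1 (by omega)

/-- RH-FREE KERNEL form at `T = 10³`: `γ ≥ 150`, `0 < δ < ½`, `b_L(γ,δ) ≤ 10⁶`, `1 ≤ n ≤ b_L ⟹ plantedLi γ δ n > 0`. -/
theorem plantedLi_pos_upTo_height1000 {γ δ : ℝ} {n : ℕ} (hγ : 150 ≤ γ) (hδ : 0 < δ) (hδ' : δ < 1 / 2)
    (hb : liBlindDegree γ δ ≤ 1000000) (hn1 : 1 ≤ n) (hnb : (n : ℝ) ≤ liBlindDegree γ δ) :
    0 < plantedLi γ δ n :=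
  plantedLi_pos_upTo (T := 1000) (by norm_num) riemannHypothesisUpTo_1000 hγ hδ hδ' (by norm_num; linarith) hn1 hnb

end RhIdea6.G15.C47b

end
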